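import Summits.QuantumFields.YangMills.Theorems.BalabanUVNodesN13UVRowOfU1TU2L2TSmallLocus
import Summits.QuantumFields.YangMills.Theorems.BalabanUVNodesN13Cor3AEKeepZeroOfEnginesRowAtRecord13

/-!
# BalabanUVNodes ∕ N13 — THE `dV`-A.E. TWIN OF THE 𝐓-IMAGE ROAD TO THE (UV₁₃) ROW: termwise a.e. majorants (U1)ᵀ of the PRE-𝐑 terms + their budget (U2) ⟹ the upper half a.e.;
# the all-small history's pre-𝐑 lower bound (L2ˢ)ᵀ a.e. on the small locus ⟹ the lower half a.e. there; with Theorem 1 + the level-0 row ⟹ the K1⁹ (B)-slot letter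
# `∃ v : Revision₁₃ θ h, B16.EndStatementBPrinted (datumOfRecord₁₃SepCoPHⱽ θ h v).C`

Cell `pub-ymgap` (HUMAN RULING D-0062 Track A ∕ D-0149 width), WIDTH SEAT `pub-ymgap-dag-n13-w2` (gen 4, CLAIM-4, INBOX l.35301), key K1⁸ `StabilityBRunRowsAtRecordR13SepCoPH` = stmt-QuantumFields-26907
(`--kind proof --supports … --as helper`; count-neutral).  LINEAGE: dag-n13-w1's 𝐓-image road (p597573 ∕ p600126 ∕ p609730 `…N13UVRowOfU1TU2L2TSmallLocus`), HANDED to this seat by the owner's word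
«n13-w2 take (o1)» (INBOX l.≈35290); pointwise parents cited BY NAME, nothing restated.  WHY: director-ym №210 (5) — after the (δ) repair the Cor-3 rows at levels ≥ 1 are asked VERSION-FREE
(`dV`-a.e.); the pointwise road's leaves are replaced by their a.e. forms and the conclusion feeds this seat's p621421 (`…N13Cor3AEKeepZeroOfEnginesRowAtRecord13` §3∕§4) to the version slot of node00
DEF-1 (p620607).  [III] = [Balaban1988Convergent], [IV] = [Balaban1989LargeFieldI], [B16] = [Balaban1989LargeFieldII], [Av] = [Balaban1985Averaging].

WHAT THIS FILE PROVES (theorems only; 0 `def`; no `instance`, no `notation`; standard axioms; NO route-file import).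
§1 [folklore] `ae_finset_sum_le_of_forall_ae_le` — over a finite index type, termwise a.e. bounds sum to an a.e. bound (`Filter.eventually_all`).
§2 (`θ : Stage13Params` with the live-selector clause and the two ζ-laws; any level `k`): ★ `ae_densOfRecord₁₃_le_of_aeU1T_U2_of_liveSel` (a.e. termwise majorants `χ_k(s)·slotT_k(s) ≤ major s` + the budget
   `Σ major ≤ e^{ep|T|}` ⟹ `∀ᵐ V, ρ_k V ≤ e^{ep|T|}`, through the POINTWISE `ρ_k ≤ Σ_s χ_k(s)·slotT_k(s)` of p609730) · ★ `ae_uvLowerSmall₁₃_of_aeL2T_of_fibOfSeq_eq_empty_of_liveSel` ((L2ˢ)ᵀ a.e. on the small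
   locus for a history with EMPTY fibre bond set ⟹ the lower half a.e. on the small locus, through the POINTWISE `χ_k(s₀)·slotT_k(s₀) ≤ ρ_k` of p609730).
§3 (`θ : Stage13HParams`, `h : Provisos₁₃SepCoPH`, selector clause `hsel`, `εreg` in [Av] Prop. 2's range) ★★★ `exists_revision₁₃_endStatementBPrinted_of_thm1_of_row0_of_aeU1T_U2_aeL2Tsmall_of_liveSel` —
   Theorem 1 at the datum + the level-0 row at every field + the three leaves at levels `k+1 ≤ K` ((U1)ᵀ, (L2ˢ)ᵀ with «∀ V» replaced by «∀ᵐ V ∂fieldMeasure», (U2) a number) ⟹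
   `∃ v : Revision₁₃ F N θ h, B16.EndStatementBPrinted (datumOfRecord₁₃SepCoPHV F N θ h v).C` (p621421 `…_of_thm1_of_row0_of_aeUpper_of_aeLowerSmall` BY NAME).

HONEST FRAMING.  Count-neutral bookkeeping; the leaves (U1)ᵀ ∕ (U2) ∕ (L2ˢ)ᵀ are HYPOTHESES — [III] §3 ∕ Thm 2 ((2.43)–(2.44) p.263; the effective-action bounds (2.49) p.264 they yield) ∕ [IV] (1.89)-type content, LOCATED, nobody's theorem here; Theorem 1 at the datum is
N11's T-row + [IV] selector laws (p583899); nothing of Bałaban's asserted or refuted; K1⁸ NEITHER proved NOR refuted; N13 NOT discharged; no stub closed; counts unmoved (typed 28∕28 · discharged 5∕28 ·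
A 5∕28); one finite `𝕋⁴_{L^K}` programme at fixed `ε = L^{−K}`, Bałaban AS PRINTED; route R4 closes the CONDITIONAL finite-𝕋⁴ rung `BalabanLadder.UV` only — the Yang–Mills mass gap (Clay) is NOT proved
by any of this; nothing continuum ∕ ℝ⁴ ∕ OS.  No `sorry`.

EDITION v1.0.1 (DOC-ONLY; every declaration byte-identical to v1.0 p623210, commit f1a67443ee33).  Folds dag-ref-M g10 READ-132 NIT-2 (INBOX l.40357): (1) LOCATOR — the v1.0 cite «Thm 2 (2.49) p.263»
conflated two pages: Theorem 2 is STATED on [III] p.263 with its displays (2.43)–(2.44); the effective-action bounds «(2.49)» that these yield are displayed on p.264 (page text p0022 L35, immediately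
before Corollary 3 and (2.50)); the three occurrences now read «Thm 2 (2.43)–(2.44) p.263, (2.49) p.264»; (2) the count phrase «discharged 5∕27» was a typo for «5∕28» (28 typed nodes).  Nothing
mathematical changed; counts UNMOVED.
-/

noncomputable section

open scoped BigOperators ENNReal Matrix.Norms.L2Operator

namespace Summit.QuantumFields.YangMills.BalabanUVNodes.N13UVRowAEOfU1TU2L2TSmallLocusAtRecord13

open MeasureTheory
open Literature.MathematicalPhysics.QuantumFieldTheory.Balaban1983to89
open Literature.MathematicalPhysics.QuantumFieldTheory.Balaban1983to89.T4Continuum (T4Family)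
open Literature.MathematicalPhysics.QuantumFieldTheory.Balaban1983to89.Node00
open B14.Eq218Concrete
open FlowStepRuns (genFlow)
open ExpMeanLog (deltaSU)
open Summit.QuantumFields.YangMills.BalabanUVNodes.N13UVRowOfU1TU2L2TSmallLocus
  (fibOfSeq_eq_empty_of_Λ_eq_univ densOfRecord₁₃_le_sum_histTermT_of_liveSel histTermT₁₃_le_densOfRecord₁₃_of_fibOfSeq_eq_empty_of_liveSel)
open Summit.QuantumFields.YangMills.BalabanUVNodes.N13Cor3AEKeepZeroOfEnginesRowAtRecord13
  (exists_revision₁₃_endStatementBPrinted_of_thm1_of_row0_of_aeUpper_of_aeLowerSmall)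

variable {F : T4Family} {N : ℕ} [NeZero N]

/-! ## §1 Finite sums of a.e. bounds -/

/-- **Termwise a.e. bounds over a FINITE index type sum to an a.e. bound.** [folklore] -/
theorem ae_finset_sum_le_of_forall_ae_le {X ι : Type*} [MeasurableSpace X] [Fintype ι] {μ : Measure X} {f : ι → X → ℝ} {m : ι → ℝ}
    (h : ∀ i, ∀ᵐ x ∂μ, f i x ≤ m i) : ∀ᵐ x ∂μ, ∑ i, f i x ≤ ∑ i, m i := by
  filter_upwards [Filter.eventually_all.2 h] with x hx
  exact Finset.sum_le_sum fun i _ => hx i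

/-! ## §2 The two halves a.e., at a live-selector `Stage13Params` -/

section Record

variable (θ : Stage13Params F N)

/-- **★ THE UPPER HALF A.E. FROM A.E. TERMWISE MAJORANTS OF THE PRE-𝐑 TERMS AND THEIR BUDGET**: `χ_k(s)·slotT_k(s) ≤ major s` for `dV`-a.e. `V` (each `s`) and `Σ_s major s ≤ exp(ep·|T₁^{(k)}|)`
⟹ `ρ_k ≤ exp(ep·|T₁^{(k)}|)` for `dV`-a.e. `V` — through p609730's POINTWISE `ρ_k(V) ≤ Σ_s χ_k(s)(V)·slotT_k(s)(V)` (live selector, ζ-laws).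
[cite: Balaban1988Convergent, (2.18) p.257, Cor. 3 (2.50) p.264, (3.24)–(3.25) p.270; Balaban1989LargeFieldI, (0.2)–(0.4) p.176 (bookkeeping)] -/
theorem ae_densOfRecord₁₃_le_of_aeU1T_U2_of_liveSel (hζu : IsZetaUnity F N θ.ν θ.τ9.M θ.ζ) (hζa : IsZetaAbsLeOne F N θ.ν θ.τ9.M θ.ζ)
    (hsel : θ.ppSel = ppSelLiveOfRecord F N θ.ν θ.τ9 (EOfRecord₁₃ F N θ) (wOfRecord₉ F N θ.toStage9Params)) (P : B12.RunParams) (k : ℕ) (ep : ℝ)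
    (major : SeqOfRecord F θ.ν θ.τ9.M (gOfRecord₁₃ F N θ P) P.K k → ℝ)
    (hU1T : ∀ s, ∀ᵐ V ∂(fieldMeasure (F.P P.K) k (SU N)), chiSeqOfRecord F N θ.ν θ.τ9.M (gOfRecord₁₃ F N θ P) P.K k s V *
        slotsTOfRecord F N θ.ν θ.τ9 (EOfRecord₁₃ F N θ) (wOfRecord₉ F N θ.toStage9Params) θ.ppSel P (gOfRecord₁₃ F N θ P) k s V ≤ major s)
    (hU2 : ∑ s, major s ≤ Real.exp (ep * (Fintype.card (Site (F.P P.K) k) : ℝ))) :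
    ∀ᵐ V ∂(fieldMeasure (F.P P.K) k (SU N)), densOfRecord₁₃ F N θ P k V ≤ Real.exp (ep * (Fintype.card (Site (F.P P.K) k) : ℝ)) := by
  filter_upwards [ae_finset_sum_le_of_forall_ae_le hU1T] with V hV
  exact (densOfRecord₁₃_le_sum_histTermT_of_liveSel θ hζu hζa hsel P k V).trans (hV.trans hU2)

/-- **★ THE LOWER HALF A.E. ON THE SMALL LOCUS FROM (L2ˢ)ᵀ A.E.**: for a history `s₀` with EMPTY fibre bond set (the all-small history, `fibOfSeq_eq_empty_of_Λ_eq_univ`), if for `dV`-a.e. `V` the lower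
barrier is `≤ χ_k(s₀)(V)·slotT_k(s₀)(V)` whenever `V` is on the small locus, then for `dV`-a.e. `V` it is `≤ ρ_k(V)` there — through p609730's POINTWISE `χ_k(s₀)·slotT_k(s₀) ≤ ρ_k`.
[cite: Balaban1988Convergent, (2.18) p.257, Thm 2 (2.43)–(2.44) p.263, (2.49) p.264, Cor. 3 (2.50) p.264; Balaban1989LargeFieldI, (0.3) p.176 and p.177 (i)–(ii) (bookkeeping)] -/
theorem ae_uvLowerSmall₁₃_of_aeL2T_of_fibOfSeq_eq_empty_of_liveSel (hζu : IsZetaUnity F N θ.ν θ.τ9.M θ.ζ) (hζa : IsZetaAbsLeOne F N θ.ν θ.τ9.M θ.ζ)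
    (hsel : θ.ppSel = ppSelLiveOfRecord F N θ.ν θ.τ9 (EOfRecord₁₃ F N θ) (wOfRecord₉ F N θ.toStage9Params)) (P : B12.RunParams) (k : ℕ) (em : ℝ)
    {s₀ : SeqOfRecord F θ.ν θ.τ9.M (gOfRecord₁₃ F N θ P) P.K k} (hfib : fibOfSeq F θ.ν θ.τ9 P (gOfRecord₁₃ F N θ P) k s₀ = ∅)
    (Small : GaugeField (F.P P.K) k (SU N) → Prop)
    (hL2T : ∀ᵐ V ∂(fieldMeasure (F.P P.K) k (SU N)), Small V →
      chiβOfRecord₁₃ F N θ P.K (gOfRecord₁₃ F N θ P) k V *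
          Real.exp (-(1 / (gOfRecord₁₃ F N θ P k) ^ 2 * wilsonBGOfRecord F N θ.εbg P k V) - em * (Fintype.card (Site (F.P P.K) k) : ℝ)) ≤
        chiSeqOfRecord F N θ.ν θ.τ9.M (gOfRecord₁₃ F N θ P) P.K k s₀ V *
          slotsTOfRecord F N θ.ν θ.τ9 (EOfRecord₁₃ F N θ) (wOfRecord₉ F N θ.toStage9Params) θ.ppSel P (gOfRecord₁₃ F N θ P) k s₀ V) :
    ∀ᵐ V ∂(fieldMeasure (F.P P.K) k (SU N)), Small V →
      chiβOfRecord₁₃ F N θ P.K (gOfRecord₁₃ F N θ P) k V *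
          Real.exp (-(1 / (gOfRecord₁₃ F N θ P k) ^ 2 * wilsonBGOfRecord F N θ.εbg P k V) - em * (Fintype.card (Site (F.P P.K) k) : ℝ)) ≤
        densOfRecord₁₃ F N θ P k V := by
  filter_upwards [hL2T] with V hV hsmall
  exact (hV hsmall).trans (histTermT₁₃_le_densOfRecord₁₃_of_fibOfSeq_eq_empty_of_liveSel θ hζu hζa hsel P k hfib V)

end Record

/-! ## §3 With Theorem 1 and the level-0 row: the K1⁹ (B)-slot letter -/

section Slot

variable (F N)
variable (θ : Stage13HParams F N) (h : θ.Provisos₁₃SepCoPH F N)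

/-- **★★★ THE K1⁹ (B)-SLOT LETTER FROM THE 𝐓-IMAGE LEAVES IN A.E. CURRENCY**: at a history-indexed parameter under `Provisos₁₃SepCoPH` with the live-selector clause `hsel` and `εreg` in [Av] Prop. 2's
range: `B16.Thm1Printed (datumOfRecord₁₃SepCoPH θ h).C`, the level-0 two-sided row at every field (`hrow0`, guard `SLaw₁₃CoPH θ P 0`), and at every level `k+1 ≤ K` on the window — termwise majorants (U1)ᵀ
`∀ s, ∀ᵐ V, χ_{k+1}(s)·slotT_{k+1}(s) ≤ major P (k+1) s`, the budget (U2) `Σ major ≤ exp(ep(g_{k+1})·|T|)`, and the all-small history's lower bound (L2ˢ)ᵀ `∀ᵐ V` on the small locus (index `s₀ P (k+1)` with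
`Λ_{k+1} = univ`) ⟹ `∃ v : Revision₁₃ F N θ h, B16.EndStatementBPrinted (datumOfRecord₁₃SepCoPHV F N θ h v).C` (§2 + p621421's producer through node00 DEF-1's adapter).  Every leaf is a HYPOTHESIS.
[cite: Balaban1989LargeFieldII, Thm 1 + (0.1) pp.355–356; Balaban1988Convergent, Thm 1 p.262, (2.18) p.257, Thm 2 (2.43)–(2.44) p.263, (2.49) p.264, Cor. 3 (2.50) p.264, (3.24)–(3.25) p.270; Balaban1989LargeFieldI, (0.3) p.176, p.177 (i)–(ii); Balaban1985Averaging, Prop. 2 (54) p.26 (bookkeeping)] -/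
theorem exists_revision₁₃_endStatementBPrinted_of_thm1_of_row0_of_aeU1T_U2_aeL2Tsmall_of_liveSel
    (hsel : θ.ppSel = ppSelLiveOfRecord F N θ.ν θ.τ9 (EOfRecord₁₃ F N θ.toStage13Params) (wOfRecord₉ F N θ.toStage9Params))
    (hε : 0 < θ.ν.εreg) (hε3 : (143 * ((((4 + 4 : ℕ) : ℝ)) ^ 2 / 4) ^ 2) * θ.ν.εreg ≤ 1 / 3) (hε2 : 2 * θ.ν.εreg ≤ 2 * deltaSU (Fin N) / ((((4 + 4) * F.L : ℕ) : ℝ) ^ 2))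
    (h1 : B16.Thm1Printed (datumOfRecord₁₃SepCoPH F N θ h).C) {γ : ℝ} (hγ : 0 < γ) {em ep : ℝ → ℝ}
    (hrow0 : ∀ P : B12.RunParams, ((datumOfRecord₁₃SepCoPH F N θ h).C P).flow.InInterval γ P.K → SLaw₁₃CoPH F N θ P 0 →
      ∀ U : GaugeField (F.P P.K) 0 (SU N),
        chiβOfRecord₁₃ F N θ.toStage13Params P.K (gOfRecord₁₃ F N θ.toStage13Params P) 0 U *
              Real.exp (-(1 / (gOfRecord₁₃ F N θ.toStage13Params P 0) ^ 2 * wilsonBGOfRecord F N θ.εbg P 0 U)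
                - em (gOfRecord₁₃ F N θ.toStage13Params P 0) * (Fintype.card (Site (F.P P.K) 0) : ℝ)) ≤ densOfRecord₁₃ F N θ.toStage13Params P 0 U ∧
          densOfRecord₁₃ F N θ.toStage13Params P 0 U ≤ Real.exp (ep (gOfRecord₁₃ F N θ.toStage13Params P 0) * (Fintype.card (Site (F.P P.K) 0) : ℝ)))
    (major : (P : B12.RunParams) → (k : ℕ) → SeqOfRecord F θ.ν θ.τ9.M (gOfRecord₁₃ F N θ.toStage13Params P) P.K k → ℝ)
    (s₀ : (P : B12.RunParams) → (k : ℕ) → SeqOfRecord F θ.ν θ.τ9.M (gOfRecord₁₃ F N θ.toStage13Params P) P.K k)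
    (hΛ : ∀ (P : B12.RunParams) (k : ℕ), (s₀ P k).Λ k = Set.univ)
    (hU1T : ∀ P : B12.RunParams, ((datumOfRecord₁₃SepCoPH F N θ h).C P).flow.InInterval γ P.K → ∀ k, k + 1 ≤ P.K → SLaw₁₃CoPH F N θ P (k + 1) →
      ∀ s, ∀ᵐ V ∂(fieldMeasure (F.P P.K) (k + 1) (SU N)), chiSeqOfRecord F N θ.ν θ.τ9.M (gOfRecord₁₃ F N θ.toStage13Params P) P.K (k + 1) s V *
        slotsTOfRecord F N θ.ν θ.τ9 (EOfRecord₁₃ F N θ.toStage13Params) (wOfRecord₉ F N θ.toStage9Params) θ.ppSel P (gOfRecord₁₃ F N θ.toStage13Params P) (k + 1) s V ≤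
          major P (k + 1) s)
    (hU2 : ∀ P : B12.RunParams, ((datumOfRecord₁₃SepCoPH F N θ h).C P).flow.InInterval γ P.K → ∀ k, k + 1 ≤ P.K → SLaw₁₃CoPH F N θ P (k + 1) →
      ∑ s, major P (k + 1) s ≤ Real.exp (ep (gOfRecord₁₃ F N θ.toStage13Params P (k + 1)) * (Fintype.card (Site (F.P P.K) (k + 1)) : ℝ)))
    (hL2Tsmall : ∀ P : B12.RunParams, ((datumOfRecord₁₃SepCoPH F N θ h).C P).flow.InInterval γ P.K → ∀ k, k + 1 ≤ P.K → SLaw₁₃CoPH F N θ P (k + 1) →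
      ∀ᵐ V ∂(fieldMeasure (F.P P.K) (k + 1) (SU N)),
        (∀ q : Plaq (F.P P.K) (k + 1), ¬ IsB0 (F := F) (⟨q.src, q.μ⟩ : PBond (F.P P.K) (k + 1)) → ¬ IsB0 (F := F) (⟨q.src.shift q.μ, q.ν⟩ : PBond (F.P P.K) (k + 1)) →
          ¬ IsB0 (F := F) (⟨q.src.shift q.ν, q.μ⟩ : PBond (F.P P.K) (k + 1)) → ¬ IsB0 (F := F) (⟨q.src, q.ν⟩ : PBond (F.P P.K) (k + 1)) →
          dist1 (GaugeField.plaqHol V q) < 2 * θ.ν.εreg + 4 * θ.ε₂₉) →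
        chiβOfRecord₁₃ F N θ.toStage13Params P.K (gOfRecord₁₃ F N θ.toStage13Params P) (k + 1) V *
            Real.exp (-(1 / (gOfRecord₁₃ F N θ.toStage13Params P (k + 1)) ^ 2 * wilsonBGOfRecord F N θ.εbg P (k + 1) V)
              - em (gOfRecord₁₃ F N θ.toStage13Params P (k + 1)) * (Fintype.card (Site (F.P P.K) (k + 1)) : ℝ)) ≤
          chiSeqOfRecord F N θ.ν θ.τ9.M (gOfRecord₁₃ F N θ.toStage13Params P) P.K (k + 1) (s₀ P (k + 1)) V *
            slotsTOfRecord F N θ.ν θ.τ9 (EOfRecord₁₃ F N θ.toStage13Params) (wOfRecord₉ F N θ.toStage9Params) θ.ppSel P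
              (gOfRecord₁₃ F N θ.toStage13Params P) (k + 1) (s₀ P (k + 1)) V) :
    ∃ v : Revision₁₃ F N θ h, B16.EndStatementBPrinted (datumOfRecord₁₃SepCoPHV F N θ h v).C :=
  exists_revision₁₃_endStatementBPrinted_of_thm1_of_row0_of_aeUpper_of_aeLowerSmall F N θ h hε hε3 hε2 h1 hγ hrow0
    (fun P hP k hk hS => ae_densOfRecord₁₃_le_of_aeU1T_U2_of_liveSel θ.toStage13Params h.zetaUnity h.zetaAbs hsel P (k + 1) _ (major P (k + 1))
      (hU1T P hP k hk hS) (hU2 P hP k hk hS))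
    (fun P hP k hk hS => ae_uvLowerSmall₁₃_of_aeL2T_of_fibOfSeq_eq_empty_of_liveSel θ.toStage13Params h.zetaUnity h.zetaAbs hsel P (k + 1) _
      (fibOfSeq_eq_empty_of_Λ_eq_univ θ.ν θ.τ9 P _ (k + 1) (s₀ P (k + 1)) (hΛ P (k + 1))) _ (hL2Tsmall P hP k hk hS))

end Slot

end Summit.QuantumFields.YangMills.BalabanUVNodes.N13UVRowAEOfU1TU2L2TSmallLocusAtRecord13

end
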